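import Literature.AlgebraicGeometry.Frobenioids.GeometricFrobenioidModel
import Literature.AlgebraicGeometry.Frobenioids.ModelFrobenioidMap
import Literature.AlgebraicGeometry.Frobenioids.PadicFrobenioidGoodLocalKit
import HarnessLib

/-!
# Frobenioids I, Theorem 6.2 (i): the functor `Ψ : C₁ → C₂` induced by a dominant morphism — CONSTRUCTED
# for every pull-back datum, and abc-iut-L1-t3's schema `Thm62i` PROVED at the constructed models

Mochizuki, *The geometry of Frobenioids I: the general theory*, Kyushu J. Math. **62** (2008) 293–400,
Theorem 6.2 (i), kurims text p. 110 l. 45 – p. 111 l. 5: "Let `ψ : V₂ → V₁` be a dominant morphism of schemes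
such that … (a) `D_{K₂}` is equal to the set of prime divisors of `V₂` that map into a prime divisor of `D_{K₁}`;
(b) … `K₁ ↪ K₂ ↪ K̃₂` factors through `K̃₁`; (c) `K₁` is separably closed in `K₂`. Then `ψ` induces a functor
`Ψ : C₁ → C₂` [well-defined up to isomorphism] that is compatible with Frobenius degrees, the functor `D₁ → D₂`
induced by the inclusion of fields `K₁ ↪ K₂`, and the natural transformations `Φ₁ → Φ₂|_{D₁}`, `B₁ → B₂|_{D₁}`
induced by pulling back divisors and rational functions, respectively, via `ψ`"; proof p. 111 l. 28–33: "by
pulling back [Cartier] divisors and rational functions via `ψ`, we obtain compatible natural transformations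
`Φ₁ → Φ₂|_{D₁}`, `B₁ → B₂|_{D₁}`. Thus, it follows formally from the definition of the category underlying a
model Frobenioid in Theorem 5.2, (i), that we obtain a functor `Ψ : C₁ → C₂` satisfying the properties stated in
assertion (i)". [cite: MochizukiFrdI2008, Thm. 6.2 (i) p.110]

WHAT IS HERE (seat abc-iut-w5-d048, sub-DAG W5 rows T62i/L03–L06 of abc-iut-L1-t3's SUBDAG-FrdI-Thm62;
CONSTRUCTIONS and THEOREMS only — no `Prop`-valued named fact is introduced):
* §1 (generic, the "formally from Theorem 5.2 (i)" step, over ANY base functor `G : D₁ ⥤ D₂`):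
  `ModelFrobenioid.DataHomOver G DivB₁ DivB₂` — a morphism of model data `(Φ₁, B₁, Div_{B₁}) → (Φ₂, B₂, Div_{B₂})`
  OVER `G` = abc-iut-L1-t5's `ModelFrobenioid.DataHom` into the data restricted along `G`
  (abc-iut-L1-t4's `ModelFrobenioid.divBRestrict`); `DataHomOver.functor` := `DataHom.functor ⋙ baseChange G` — the
  induced functor of model Frobenioids `(A_D, α) ↦ (G A_D, η^gp α)`, `(d, f, Div, u) ↦ (d, G f, η Div, β u)` —
  with its compatibilities `functor_comp_baseFunctor` (with `D₁ → D₂`), `degFr_functor_map` (Frobenius degrees),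
  `div_functor_map` (with `Φ₁ → Φ₂|_{D₁}`), `unit_functor_map` (with `B₁ → B₂|_{D₁}`), all definitional.
* §2 (geometric): for geometric divisor data `Γ₁` over `K̃₁/K₁`, `Γ₂` over `K̃₂/K₂` and a base functor
  `βψ : D₁ ⥤ D₂`, a PULL-BACK DATUM `GeometricDivisorData.PullbackDatum Γ₁ Γ₂ βψ` := a `DataHomOver βψ` between the
  model data of Ex. 6.1 (abc-iut-L6-t10's `geomDivisorFunctor` / `geomUnitsFunctor` / `geomDivNatTrans`) — exactly
  the "compatible natural transformations `Φ₁ → Φ₂|_{D₁}`, `B₁ → B₂|_{D₁}`" of the printed proof (their derivation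
  from the scheme-theoretic hypothesis (a) is not expressible in the tree's language and stays DATA, as t3's
  `frobeniusPhi` / `frobeniusB` are); THEN `PullbackDatum.thm62i_of_pullbackDatum` — abc-iut-L1-t3's schema
  `Thm62i (geomModelFrobenioid Γ₁) (geomModelFrobenioid Γ₂) βψ (φψ of the datum)` HOLDS FOR EVERY PULL-BACK DATUM,
  witnessed by the constructed functor; `unit_inducedFunctor_map` — the fourth printed compatibility (with
  `B₁ → B₂|_{D₁}`), which the schema does not render; and (consistency with Thm. 6.2 (ii)) the Frobenius datum
  `GeometricDivisorData.frobeniusPullbackDatum p` (base functor `𝟭`, `D ↦ p·D`, `f ↦ f^p`; the compatibility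
  `div(f^p) = p·div(f)` is t3's `div_frobeniusB`, re-proved pointwise here) with `Thm62i_frobenius_holds'`
  re-deriving abc-iut-L6-t10's `Thm62i_frobenius_holds`.
NOT here (rows T62i/L01–L02 of the sub-DAG): the construction of `βψ` itself from (b)(c) as the compositum functor
`L₁ ↦ L₁·K₂` with `[L₁·K₂ : K₂] = [L₁ : K₁]` (classical field theory: linear disjointness of a separable algebraic
extension from an extension in which the base is separably closed). Nothing here bears on [IUTchIII] or abc.
-/

noncomputable section

namespace Literature.AlgebraicGeometry.Frobenioids

open CategoryTheory Opposite

/-! ## §1. Model Frobenioids: the functor induced by a morphism of model data OVER a base functor -/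

namespace ModelFrobenioid

universe w v₁ v₂ u₁ u₂

variable {D₁ : Type u₁} [Category.{v₁} D₁] {D₂ : Type u₂} [Category.{v₂} D₂]
  {Φ₁ B₁ : D₁ᵒᵖ ⥤ CommMonCat.{w}} {Φ₂ B₂ : D₂ᵒᵖ ⥤ CommMonCat.{w}}

/-- A **morphism of model data over a base functor** `G : D₁ ⥤ D₂`: homomorphisms of monoids on `D₁`,
`η : Φ₁ → Φ₂|_{D₁}` and `β : B₁ → B₂|_{D₁}` (restrictions along `G`), compatible with the divisor maps
`Div_{B₁}`, `Div_{B₂}|_{D₁}` — "compatible natural transformations `Φ₁ → Φ₂|_{D₁}`, `B₁ → B₂|_{D₁}`" (Thm. 6.2 (i),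
proof p. 111 l. 28–31); abc-iut-L1-t5's `DataHom` into abc-iut-L1-t4's restricted data `divBRestrict G`.
[cite: MochizukiFrdI2008, Thm. 6.2 (i) p.111] -/
abbrev DataHomOver (G : D₁ ⥤ D₂) (DivB₁ : B₁ ⟶ monoidGp Φ₁) (DivB₂ : B₂ ⟶ monoidGp Φ₂) :=
  DataHom DivB₁ (divBRestrict G Φ₂ B₂ DivB₂)

namespace DataHomOver

variable {G : D₁ ⥤ D₂} {DivB₁ : B₁ ⟶ monoidGp Φ₁} {DivB₂ : B₂ ⟶ monoidGp Φ₂}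
  (h : DataHomOver G DivB₁ DivB₂)

/-- **"It follows formally from the definition of the category underlying a model Frobenioid in Theorem 5.2, (i),
that we obtain a functor `Ψ : C₁ → C₂`"** (Thm. 6.2 (i), proof p. 111 l. 31–33): the functor of model Frobenioids
induced by a morphism of model data over `G` — change of data on `D₁` (abc-iut-L1-t5's `DataHom.functor`)
followed by change of base along `G` (abc-iut-L1-t4's `baseChange`): `(A_D, α) ↦ (G A_D, η^gp α)`,
`(d, f, Div, u) ↦ (d, G f, η Div, β u)`. [cite: MochizukiFrdI2008, Thm. 6.2 (i) p.111] -/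
def functor : ModelFrobenioid Φ₁ B₁ DivB₁ ⥤ ModelFrobenioid Φ₂ B₂ DivB₂ :=
  DataHom.functor h ⋙ baseChange G Φ₂ B₂ DivB₂

/-- The induced functor on objects: `(A_D, α) ↦ (G A_D, η^gp(α))`. [cite: MochizukiFrdI2008, Thm. 6.2 (i) p.111] -/
theorem functor_obj (X : ModelFrobenioid Φ₁ B₁ DivB₁) :
    h.functor.obj X = ⟨G.obj X.base, gpApp h.η (op X.base) X.cls⟩ := rfl

/-- "compatible with … the functor `D₁ → D₂`": `Ψ ⋙ Base = Base ⋙ G`. [cite: MochizukiFrdI2008, Thm. 6.2 (i) p.110] -/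
theorem functor_comp_baseFunctor :
    h.functor ⋙ baseFunctor Φ₂ B₂ DivB₂ = baseFunctor Φ₁ B₁ DivB₁ ⋙ G := rfl

/-- `Base(Ψ φ) = G (Base φ)`. [cite: MochizukiFrdI2008, Thm. 6.2 (i) p.110] -/
theorem baseMap_functor_map {X Y : ModelFrobenioid Φ₁ B₁ DivB₁} (φ : X ⟶ Y) :
    baseMap (h.functor.map φ) = G.map (baseMap φ) := rfl

/-- "compatible with Frobenius degrees": `deg_Fr(Ψ φ) = deg_Fr(φ)`. [cite: MochizukiFrdI2008, Thm. 6.2 (i) p.110] -/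
theorem degFr_functor_map {X Y : ModelFrobenioid Φ₁ B₁ DivB₁} (φ : X ⟶ Y) :
    degFr (h.functor.map φ) = degFr φ := rfl

/-- "compatible with … `Φ₁ → Φ₂|_{D₁}`": `Div(Ψ φ) = η(Div φ)`. [cite: MochizukiFrdI2008, Thm. 6.2 (i) p.110] -/
theorem div_functor_map {X Y : ModelFrobenioid Φ₁ B₁ DivB₁} (φ : X ⟶ Y) :
    div (h.functor.map φ) = (h.η.app (op X.base)).hom (div φ) := rfl

/-- "compatible with … `B₁ → B₂|_{D₁}`": `u_{Ψ φ} = β(u_φ)`. [cite: MochizukiFrdI2008, Thm. 6.2 (i) p.110] -/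
theorem unit_functor_map {X Y : ModelFrobenioid Φ₁ B₁ DivB₁} (φ : X ⟶ Y) :
    unit (h.functor.map φ) = (h.β.app (op X.base)).hom (unit φ) := rfl

end DataHomOver

end ModelFrobenioid

/-! ## §2. Geometric Frobenioids: Theorem 6.2 (i) at the constructed models, for every pull-back datum -/

section Geometric

variable {K₁ : Type} [Field K₁] {Kt₁ : Type} [Field Kt₁] [Algebra K₁ Kt₁]
  {K₂ : Type} [Field K₂] {Kt₂ : Type} [Field Kt₂] [Algebra K₂ Kt₂]

namespace GeometricDivisorData

variable (Γ₁ : GeometricDivisorData K₁ Kt₁) (Γ₂ : GeometricDivisorData K₂ Kt₂)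
  (βψ : FinSubextCat K₁ Kt₁ ⥤ FinSubextCat K₂ Kt₂)

/-- **The pull-back datum of a dominant morphism `ψ : V₂ → V₁`** over the base functor `βψ : D₁ → D₂` it induces
(Thm. 6.2 (i), proof p. 111 l. 28–31: "by pulling back [Cartier] divisors and rational functions via `ψ`, we obtain
compatible natural transformations `Φ₁ → Φ₂|_{D₁}`, `B₁ → B₂|_{D₁}`"): monoid maps `Φ₁(L₁) → Φ₂(βψ L₁)` and
`B₁(L₁) → B₂(βψ L₁)`, natural in `L₁`, compatible with `div` — a morphism OVER `βψ` between the model data of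
Ex. 6.1 (abc-iut-L6-t10's `geomDivisorFunctor`, `geomUnitsFunctor`, `geomDivNatTrans`). DATA (the scheme-theoretic
derivation from hypothesis (a) is not in the tree's language). [cite: MochizukiFrdI2008, Thm. 6.2 (i) p.111] -/
abbrev PullbackDatum : Type _ :=
  ModelFrobenioid.DataHomOver βψ (geomDivNatTrans Γ₁) (geomDivNatTrans Γ₂)

variable {Γ₁ Γ₂ βψ}

namespace PullbackDatum

variable (h : PullbackDatum Γ₁ Γ₂ βψ)

/-- **The functor `Ψ : C₁ → C₂` of Theorem 6.2 (i)** for the geometric Frobenioids `C_{K̃₁/K₁}`, `C_{K̃₂/K₂}`,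
induced by a pull-back datum. [cite: MochizukiFrdI2008, Thm. 6.2 (i) p.110] -/
abbrev inducedFunctor : geomFrobenioid Γ₁ ⥤ geomFrobenioid Γ₂ :=
  ModelFrobenioid.DataHomOver.functor h

/-- `Ψ` lies over `βψ`: `Ψ ⋙ Base = Base ⋙ βψ`. [cite: MochizukiFrdI2008, Thm. 6.2 (i) p.110] -/
theorem inducedFunctor_comp_base :
    h.inducedFunctor ⋙ (geomFrobenioidOps Γ₂).base = (geomFrobenioidOps Γ₁).base ⋙ βψ := rfl

/-- `deg_Fr(Ψ φ) = deg_Fr(φ)`. [cite: MochizukiFrdI2008, Thm. 6.2 (i) p.110] -/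
theorem degFr_inducedFunctor_map {A A' : geomFrobenioid Γ₁} (φ : A ⟶ A') :
    (geomFrobenioidOps Γ₂).degFr (h.inducedFunctor.map φ) = (geomFrobenioidOps Γ₁).degFr φ := rfl

/-- `Div(Ψ φ) = φψ(Div φ)` with `φψ` the divisor component of the datum. [cite: MochizukiFrdI2008, Thm. 6.2 (i) p.110] -/
theorem div_inducedFunctor_map {A A' : geomFrobenioid Γ₁} (φ : A ⟶ A') :
    ModelFrobenioid.div (h.inducedFunctor.map φ) = (h.η.app (op A.base)).hom (ModelFrobenioid.div φ) := rfl

/-- **The fourth printed compatibility, "and `B₁ → B₂|_{D₁}`"** (not rendered by the `(Base, Div, deg_Fr)`-schema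
`Thm62i`): `u_{Ψ φ} = bψ(u_φ)` with `bψ` the rational-function component of the datum.
[cite: MochizukiFrdI2008, Thm. 6.2 (i) p.110] -/
theorem unit_inducedFunctor_map {A A' : geomFrobenioid Γ₁} (φ : A ⟶ A') :
    ModelFrobenioid.unit (h.inducedFunctor.map φ) = (h.β.app (op A.base)).hom (ModelFrobenioid.unit φ) := rfl

/-- **Theorem 6.2 (i) at the constructed models, for EVERY pull-back datum**: abc-iut-L1-t3's schema
`Thm62i (geomModelFrobenioid Γ₁) (geomModelFrobenioid Γ₂) βψ φψ` — "`ψ` induces a functor `Ψ : C₁ → C₂` … compatible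
with Frobenius degrees, the functor `D₁ → D₂` …, and the natural transformation `Φ₁ → Φ₂|_{D₁}`" — HOLDS with `φψ` the
divisor component of the datum, witnessed by `inducedFunctor` (base comparison = identity).
[cite: MochizukiFrdI2008, Thm. 6.2 (i) p.110] -/
theorem thm62i_of_pullbackDatum [IsGalois K₂ Kt₂] :
    Thm62i (geomModelFrobenioid Γ₁) (geomModelFrobenioid Γ₂) βψ (fun X => (h.η.app (op X)).hom) := by
  refine ⟨h.inducedFunctor, NatIso.ofComponents (fun _ => Iso.refl _) ?_, fun A B f => rfl, fun A B f => ?_⟩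
  · intro A A' φ
    simp only [Functor.comp_map, Iso.refl_hom]
    rfl
  · change ModelFrobenioid.div (h.inducedFunctor.map f) =
      (geomFrobenioidOps Γ₂).pull (𝟙 (βψ.obj A.base)) ((h.η.app (op A.base)).hom (ModelFrobenioid.div f))
    rw [(geomFrobenioidOps Γ₂).pull_id]
    rfl

end PullbackDatum

/-! ### Consistency with Theorem 6.2 (ii): the Frobenius morphism's pull-back datum -/

variable (Γ : GeometricDivisorData K₁ Kt₁)

/-- On a groupification, `(· ^ p)^gp = (· ^ p)`. [folklore] -/
private theorem monGp_map_powMonoidHom {M : Type} [CommMonoid M] (p : ℕ) :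
    MonGp.map (powMonoidHom (α := M) p) = powMonoidHom p :=
  MonGp.hom_ext fun a => by rw [MonGp.map_of, powMonoidHom_apply, powMonoidHom_apply, map_pow]

/-- **The pull-back datum of the Frobenius morphism** `ψ : V → V` in characteristic `p` (Thm. 6.2 (ii), p. 111
l. 6–12: "the Frobenius morphism … satisfies the conditions of (i)"): base functor `𝟭_D` (`L = K·L^p`), divisors
`D ↦ p·D` (abc-iut-L1-t3's `frobeniusPhi`), rational functions `f ↦ f^p` (`frobeniusB`), compatibility
`div(f^p) = p·div(f)`. [cite: MochizukiFrdI2008, Thm. 6.2 (ii) p.111] -/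
def frobeniusPullbackDatum (p : ℕ) : PullbackDatum Γ Γ (𝟭 (FinSubextCat K₁ Kt₁)) where
  η :=
    { app := fun X => CommMonCat.ofHom (Γ.frobeniusPhi p X.unop)
      naturality := fun X Y f => by
        apply CommMonCat.hom_ext
        refine MonoidHom.ext fun x => ?_
        change Γ.frobeniusPhi p Y.unop (Γ.pullPhi f.unop x) = Γ.pullPhi f.unop (Γ.frobeniusPhi p X.unop x)
        exact (map_pow (Γ.pullPhi f.unop) x p).symm }
  β :=
    { app := fun X => CommMonCat.ofHom (Γ.frobeniusB p X.unop)
      naturality := fun X Y f => by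
        apply CommMonCat.hom_ext
        refine MonoidHom.ext fun x => ?_
        change Γ.frobeniusB p Y.unop (Γ.mapB f.unop x) = Γ.mapB f.unop (Γ.frobeniusB p X.unop x)
        exact (map_pow (Γ.mapB f.unop) x p).symm }
  comm := fun X u => by
    change MonGp.map (powMonoidHom p) (divB _ _ (geomDivNatTrans Γ) X u) =
      divB _ _ (geomDivNatTrans Γ) X (u ^ p)
    rw [monGp_map_powMonoidHom, powMonoidHom_apply, map_pow]

/-- **Consistency with Theorem 6.2 (ii)**: `thm62i_of_pullbackDatum` at the Frobenius datum re-derives abc-iut-L6-t10's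
`Thm62i_frobenius_holds` (the schema at base functor `𝟭` and divisor maps `frobeniusPhi p`), now as an INSTANCE of
the general functoriality. [cite: MochizukiFrdI2008, Thm. 6.2 (ii) p.111] -/
theorem Thm62i_frobenius_holds' [IsGalois K₁ Kt₁] (p : ℕ) :
    Thm62i (geomModelFrobenioid Γ) (geomModelFrobenioid Γ) (𝟭 (FinSubextCat K₁ Kt₁))
      (fun X => Γ.frobeniusPhi p X) :=
  (Γ.frobeniusPullbackDatum p).thm62i_of_pullbackDatum

end GeometricDivisorData

end Geometric

end Literature.AlgebraicGeometry.Frobenioids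

end
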